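/- Copyright: the b2b-balaban cell (near-miss cell 7), T⁴-continuum fan-out, lineage t4-ne7b-p1 (node U5c COUNT
member).  Released under the licence of the surrounding project. -/
import Summits.QuantumFields.BalabanUV.T4Continuum.Support.HistoryGenealogyPedigree

/-!
# THE PEDIGREE OF A COMPONENT HISTORY, part 2 (junction M4, brick 2a — timing read off, and a decided toy): the last
step and the root step of a component's `PGen` are at most its level (owner module of row NE7b, lineage `t4-ne7b-p1`
gen 41; re-open object (α), `SCOPE-alpha.md` v2.2 §5 row M4 — PRE-POSITIONING ONLY)

Summits-side support leaf of the T⁴-continuum cell (rung (B)+1 on a FINITE torus only; NOT infinite volume, NOT the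
mass gap, NOT the Clay statement; NOT a proof of the spine estimate NE7b, which is the cell's OWN estimate, NOT PRINTED
and NOT PROVED).  [folklore] finite combinatorics over part 1 (`pedOf`, `OrderOK`, the `toPGen` unfoldings) and row
S13∕S13-R; PROCESS-AGNOSTIC; nothing printed is asserted, no `def … : Prop` fact of Bałaban's, zero `sorry`.

WHAT IS PROVED.  `lastStep_chainJoin_cons`, `rootStep_chainJoin_le`; **`lastStep_rootStep_toPGen_le`** (under `WF` and
an admissible order, by induction on the level through print's trichotomy): for `c ∈ comp j`,
`(toPGen cell (j, c)).lastStep ≤ j` and `.rootStep ≤ j`; corollaries `lastStep_toPGen_le`, `rootStep_toPGen_le`.  Sanity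
(decided toy over `ℕ`-labels): two regions born at level `0`, the second renewed by the 𝐑-operation of level `0` and
joined with the first at level `1` — parts lists and the `PGen` `join (birth 0 3 1) (renew (birth 0 4 2) 0) 1` by `rfl`∕
`simp` through the unfoldings.

HONEST.  Proves nothing of Bałaban's; NE7b NOT proved; spine 0∕9.  HONEST DEPENDENCY (cell): continuum YM on T⁴ ⇐
BetaPertH ∧ nine spine estimates (0/9 proved); BetaPertH ⇐ (D1) ∧ (D4) ∧ CAP+tail; G-an2-4 gates asym, D1 and NE2/3/4.
This file changes none of it. -/

open Finset
open Literature.MathematicalPhysics.QuantumFieldTheory.Balaban1983to89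
open Summit.QuantumFields.BalabanUV.T4Continuum.HistoryAdmissible
open Summit.QuantumFields.BalabanUV.T4Continuum.HistoryGen
open Summit.QuantumFields.BalabanUV.T4Continuum.HistoryGenealogyExtraction

namespace Summit.QuantumFields.BalabanUV.T4Continuum.HistoryGenealogyPedigree

/-! ## §5 Timing read off: the last step and the root step of a component's `PGen` -/

section Timing

variable {γ δ : Type*} [DecidableEq γ] [Inhabited δ] {H : ComponentHistory γ} {rnw : ℕ → γ → Bool}
  {ord : ℕ → γ → List (γ ⊕ γ)} (cell : γ → δ)

/-- the last step of a chain of joins at `s` with at least one further part is `s` [folklore] -/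
theorem lastStep_chainJoin_cons {ε : Type*} (A B : PGen ε) (Bs : List (PGen ε)) (s : ℕ) :
    (chainJoin A (B :: Bs) s).lastStep = s := by
  induction Bs generalizing A B with
  | nil => rfl
  | cons C Cs ih => exact ih (PGen.join A B s) C

/-- the root step of a chain of joins is at most the head's [folklore] -/
theorem rootStep_chainJoin_le {ε : Type*} : ∀ (A : PGen ε) (Bs : List (PGen ε)) (s : ℕ),
    (chainJoin A Bs s).rootStep ≤ A.rootStep
  | _, [], _ => le_rfl
  | A, B :: Bs, s => (rootStep_chainJoin_le (PGen.join A B s) Bs s).trans (min_le_left _ _)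

/-- **THE LAST STEP OF A COMPONENT'S `PGen` IS AT MOST ITS LEVEL, AND ITS ROOT STEP TOO** (under `WF` and an admissible
order; by induction on the level through the trichotomy). [folklore] -/
theorem lastStep_rootStep_toPGen_le (hW : H.WF) (hO : OrderOK H ord) :
    ∀ (j : ℕ) (c : γ), c ∈ H.comp j →
      ((pedOf H rnw ord).toPGen cell (j, c)).lastStep ≤ j ∧ ((pedOf H rnw ord).toPGen cell (j, c)).rootStep ≤ j := by
  intro j
  induction j with
  | zero =>
      intro c hc
      -- level 0: only births (no old parts under `WF`), the list nonempty
      have hl : lefts (ord 0 c) = [] := by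
        have hp := hW.parts_zero c
        unfold ComponentHistory.parts at hp
        have hperm := (hO 0 c hc)
        have : ∀ x ∈ ord 0 c, Sum.isRight x = true := by
          intro x hx
          cases x with
          | inr n => rfl
          | inl p =>
              exact absurd ((mem_lefts_iff p _).2 (hperm.mem_iff.1 hx)) (by rw [hp]; simp)
        exact lefts_eq_nil_of_forall_isRight this
      have hne : rights (ord 0 c) ≠ [] := by
        intro h0
        have hlen := length_lefts_add_length_rights (ord 0 c)
        rw [hl, h0, (hO 0 c hc).length_eq] at hlen
        exact hW.nonempty 0 c hc (List.eq_nil_of_length_eq_zero (by simpa using hlen.symm))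
      rw [toPGen_zero H rnw ord cell hc]
      obtain ⟨n, ns, hns⟩ := List.exists_cons_of_ne_nil hne
      rw [hns, List.map_cons]
      cases ns with
      | nil => simp [Pedigree.joinP, chainJoin, PGen.lastStep, PGen.rootStep]
      | cons n' ns' =>
          simp only [Pedigree.joinP, step_pedOf, List.map_cons]
          refine ⟨le_of_eq (lastStep_chainJoin_cons _ _ _ 0), ?_⟩
          exact (rootStep_chainJoin_le _ _ 0).trans (le_of_eq rfl)
  | succ j ih =>
      intro c hc
      have hne : ord (j + 1) c ≠ [] := by
        intro h0
        have := (hO (j + 1) c hc).length_eq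
        rw [h0] at this
        exact hW.nonempty (j + 1) c hc (List.eq_nil_of_length_eq_zero (by simpa using this.symm))
      -- the `PGen` of one constituent: last step ≤ j + 1 and root step ≤ j + 1
      have hq : ∀ q ∈ ord (j + 1) c,
          (Sum.elim (fun p => if rnw j p = true then PGen.renew ((pedOf H rnw ord).toPGen cell (j, p)) j
              else (pedOf H rnw ord).toPGen cell (j, p)) (fun n => PGen.birth (j + 1) (H.cls n) (cell n)) q).lastStep
            ≤ j + 1 ∧
          (Sum.elim (fun p => if rnw j p = true then PGen.renew ((pedOf H rnw ord).toPGen cell (j, p)) j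
              else (pedOf H rnw ord).toPGen cell (j, p)) (fun n => PGen.birth (j + 1) (H.cls n) (cell n)) q).rootStep
            ≤ j + 1 := by
        intro q hq
        cases q with
        | inr n => simp [PGen.lastStep, PGen.rootStep]
        | inl p =>
            have hp : p ∈ H.comp j := hW.parts_sub j c hc p (mem_parts_of_inl_mem_ord hO hc hq)
            obtain ⟨h1, h2⟩ := ih p hp
            cases hr : rnw j p
            · simp only [Sum.elim_inl, hr]; exact ⟨h1.trans (Nat.le_succ j), h2.trans (Nat.le_succ j)⟩
            · simp only [Sum.elim_inl, hr, if_true, PGen.lastStep, PGen.rootStep]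
              exact ⟨le_rfl, h2.trans (Nat.le_succ j)⟩
      obtain ⟨q₀, qs, hqs⟩ := List.exists_cons_of_ne_nil hne
      cases qs with
      | nil =>
          rw [toPGen_succ H rnw ord cell hc, hqs]
          simp only [List.map_cons, List.map_nil, Pedigree.joinP, chainJoin]
          exact hq q₀ (by rw [hqs]; exact List.mem_cons_self)
      | cons q₁ qs' =>
          rw [toPGen_succ_chain H rnw ord cell hc hqs]
          refine ⟨le_of_eq (lastStep_chainJoin_cons _ _ _ (j + 1)), ?_⟩
          exact (rootStep_chainJoin_le _ _ (j + 1)).trans (hq q₀ (by rw [hqs]; exact List.mem_cons_self)).2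

/-- the last step of a live component's `PGen` is at most the level [folklore] -/
theorem lastStep_toPGen_le (hW : H.WF) (hO : OrderOK H ord) {j : ℕ} {c : γ} (hc : c ∈ H.comp j) :
    ((pedOf H rnw ord).toPGen cell (j, c)).lastStep ≤ j :=
  (lastStep_rootStep_toPGen_le cell hW hO j c hc).1

/-- the root step of a live component's `PGen` is at most the level [folklore] -/
theorem rootStep_toPGen_le (hW : H.WF) (hO : OrderOK H ord) {j : ℕ} {c : γ} (hc : c ∈ H.comp j) :
    ((pedOf H rnw ord).toPGen cell (j, c)).rootStep ≤ j :=
  (lastStep_rootStep_toPGen_le cell hW hO j c hc).2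

end Timing

/-! ## §6 Sanity (decided toy): two regions born at level 0, the second renewed at level 0 and joined with the first
at level 1 -/

namespace Sanity

/-- toy bookkeeping over `ℕ`-labels: level 0 has components `1`, `2` (lone births of regions `1`, `2`, classes `3`, `4`);
level 1 has one component `7` with constituents `[inl 1, inl 2]` [folklore] -/
def toyH : ComponentHistory ℕ where
  comp j := if j = 0 then {1, 2} else if j = 1 then {7} else ∅
  newReg j := if j = 0 then {1, 2} else ∅
  cls n := n + 2
  constit j c := if j = 0 then (if c = 1 then [Sum.inr 1] else if c = 2 then [Sum.inr 2] else [])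
    else if j = 1 then (if c = 7 then [Sum.inl 1, Sum.inl 2] else []) else []
  fieldIn _ _ := false

/-- toy flags: region `2` renewed by the 𝐑-operation of level `0` [folklore] -/
def toyRnw : ℕ → ℕ → Bool := fun j p => decide (j = 0 ∧ p = 2)

/-- toy order: the bookkeeping's own [folklore] -/
def toyOrd : ℕ → ℕ → List (ℕ ⊕ ℕ) := toyH.constit

/-- the parts of the level-1 component: old `(0,1)` unflagged, old `(0,2)` flagged [folklore] -/
example : (pedOf toyH toyRnw toyOrd).parts (1, 7) = [Part.old (0, 1) false, Part.old (0, 2) true] := by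
  decide

/-- the parts of a level-0 component: one birth [folklore] -/
example : (pedOf toyH toyRnw toyOrd).parts (0, 2) = [Part.new 4 2] := by decide

/-- its `PGen` (cells = labels): `join (birth 0 3 1) (renew (birth 0 4 2) 0) 1` [folklore] -/
example : (pedOf toyH toyRnw toyOrd).toPGen id (1, 7) =
    PGen.join (PGen.birth 0 3 1) (PGen.renew (PGen.birth 0 4 2) 0) 1 := by
  have h1 : (1 : ℕ) ∈ toyH.comp 0 := by decide
  have h2 : (2 : ℕ) ∈ toyH.comp 0 := by decide
  have h7 : (7 : ℕ) ∈ toyH.comp 1 := by decide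
  rw [toPGen_succ_chain toyH toyRnw toyOrd id h7 (q₀ := Sum.inl 1) (q₁ := Sum.inl 2) (qs := []) (by decide)]
  simp only [List.map_cons, List.map_nil, Sum.elim_inl, chainJoin]
  rw [toPGen_zero_birth toyH toyRnw toyOrd id h1 (n := 1) (by decide),
    toPGen_zero_birth toyH toyRnw toyOrd id h2 (n := 2) (by decide)]
  simp [toyRnw, toyH]

end Sanity

end Summit.QuantumFields.BalabanUV.T4Continuum.HistoryGenealogyPedigree
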